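import Literature.AlgebraicGeometry.Frobenioids.FiniteEtaleBase
import Mathlib.CategoryTheory.Discrete.Basic
import HarnessLib

/-!
# Frobenioids II, Definition 3.1 (v): RC-anchors, RC-(iso-)subanchors, RC-iso-subanchor type,
# RC-standard type — the kernel status of the five predicates as FACT-LIST rows

Mochizuki, *The geometry of Frobenioids II: poly-Frobenioids*, Kyushu J. Math. **62** (2008) 401–460,
§3, Definition 3.1 (v), kurims text p. 25 [cite: MochizukiFrdII2008, Def 3.1 (v) p.25]: for a totally
epimorphic category `F → D₀` over the base `D₀` of connected finite étale coverings of `Spec ℝ`, "an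
object `A` of `F` is an *RC-anchor* if `A` determines an anchor of `F[ℂ]`", "an *RC-subanchor* if there
exists a morphism `A → B` where `B` is an RC-anchor", "an *RC-iso-subanchor* if there exist an
RC-subanchor `B`, a subgroup `G ⊆ Aut_F(B)`, and a morphism `B → A` which is a mono-minimal categorical
quotient of `B` by `G`"; "`F` is of *RC-iso-subanchor type* if every object is an RC-iso-subanchor", and
"of *RC-standard type*" if (a)–(d) hold.

PROOF-ONLY companion of `FiniteEtaleBase.lean` (abc-iut cell, block F fact-proving wave; FACT-LIST rows
F-1087 `RC.IsRCAnchor`, F-1089 `RC.IsRCSubanchor`, F-1088 `RC.IsRCIsoSubanchor`, F-2354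
`RC.IsOfRCIsoSubanchorType`, F-2355 `RC.IsOfRCStandardType`).  All five are DEFINITIONS over a functor
`P : 𝓕 ⥤ D₀`, i.e. hypothesis predicates / vocabulary, not closed published facts.  In kernel:

* **their UNIVERSAL CLOSURES are FALSE as typed**: over the one-morphism category lying over the REAL
  point `Spec ℝ` (`P` constant with value `Spec ℝ`) there is no complex object, hence no RC-anchor, no
  RC-subanchor, no RC-iso-subanchor, and the category is neither of RC-iso-subanchor nor of RC-standard
  type (`RC.not_forall_isRCAnchor`, `…_isRCSubanchor`, `…_isRCIsoSubanchor`, `…_isOfRCIsoSubanchorType`,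
  `…_isOfRCStandardType`) — more generally this holds for every REAL category `F = F[ℝ]`
  (`RC.not_isRCAnchor_of_isRealCat` and its corollaries);
* INSTANCE FORMS are in the tree and are not restated: the bases of [FrdII] Prop. 3.5 (iii)
  (`ArchFrd.P35iiiStd.isOfRCStandardType`, `….isRCIsoSubanchor_a`, `ArchimedeanProp35iiiStdBaseRC.lean`),
  the standard counterexample bases (`ArchimedeanProp35iCounterexampleStd.lean`: `isRCAnchor_b`,
  `isOfRCStandardType`), the one-morphism COMPLEX base of [IUTchI] Ex. 3.4 (i)
  (`ArchFrd.ptBase_isOfRCIsoSubanchorType`, `ArchimedeanPointBaseProp35.lean`), and a negative instance at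
  an archimedean Frobenioid (`ArchimedeanNotIsoSubanchor.not_isOfRCIsoSubanchorType`).

Reading: the rows are schemata, consumable in instance form only (plan R5); refuting OUR universal closure
is not a statement about print.  No statement of the paper is strengthened.
-/

namespace Literature.AlgebraicGeometry.Frobenioids

open CategoryTheory

universe v' u'

namespace RC

variable {𝓕 : Type u'} [Category.{v'} 𝓕] (P : 𝓕 ⥤ ArchBase)

/-! ### Real categories have no RC-anchors -/

/-- A real object is not complex (`[K:ℝ] = 1 ≠ 2`). [cite: MochizukiFrdII2008, Def 3.1 (v) p.24] -/
theorem not_complexObjects_of_realObjects {A : 𝓕} (h : realObjects P A) : ¬ complexObjects P A := by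
  intro hc
  have h1 : Module.finrank ℝ (P.obj A) = 1 := h
  have h2 : Module.finrank ℝ (P.obj A) = 2 := hc
  omega

/-- In a REAL category `F = F[ℝ]` no object is an RC-anchor (an RC-anchor is complex by definition).
[cite: MochizukiFrdII2008, Def 3.1 (v) p.25] -/
theorem not_isRCAnchor_of_isRealCat (h : IsRealCat P) (A : 𝓕) : ¬ IsRCAnchor P A :=
  fun ⟨hc, _⟩ => not_complexObjects_of_realObjects P (h.real A) hc

/-- In a real category no object is an RC-subanchor. [cite: MochizukiFrdII2008, Def 3.1 (v) p.25] -/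
theorem not_isRCSubanchor_of_isRealCat (h : IsRealCat P) (A : 𝓕) : ¬ IsRCSubanchor P A :=
  fun ⟨B, hB, _⟩ => not_isRCAnchor_of_isRealCat P h B hB

/-- In a real category no object is an RC-iso-subanchor. [cite: MochizukiFrdII2008, Def 3.1 (v) p.25] -/
theorem not_isRCIsoSubanchor_of_isRealCat (h : IsRealCat P) (A : 𝓕) : ¬ IsRCIsoSubanchor P A :=
  fun ⟨B, _, _, hB, _⟩ => not_isRCSubanchor_of_isRealCat P h B hB

/-- A NONEMPTY real category is not of RC-iso-subanchor type. [cite: MochizukiFrdII2008, Def 3.1 (v) p.25] -/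
theorem not_isOfRCIsoSubanchorType_of_isRealCat (h : IsRealCat P) (A : 𝓕) :
    ¬ IsOfRCIsoSubanchorType P :=
  fun hT => not_isRCIsoSubanchor_of_isRealCat P h A (hT.isRCIsoSubanchor A)

/-- A nonempty real category is not of RC-standard type (clause (d) fails).
[cite: MochizukiFrdII2008, Def 3.1 (v) p.25] -/
theorem not_isOfRCStandardType_of_isRealCat (h : IsRealCat P) (A : 𝓕) : ¬ IsOfRCStandardType P :=
  fun hT => not_isOfRCIsoSubanchorType_of_isRealCat P h A hT.rcIsoSubanchor

/-! ### The one-morphism category over the real point `Spec ℝ` -/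

/-- `Spec ℝ ∈ D₀` is a real object: `[ℝ:ℝ] = 1`. [cite: MochizukiFrdII2008, Def 3.1 (v) p.24] -/
theorem isReal_base : ArchBase.IsReal (FinEtale.base ℝ) := Module.finrank_self ℝ

/-- The one-morphism category lying constantly over `Spec ℝ` is a real category `F = F[ℝ]`.
[cite: MochizukiFrdII2008, Def 3.1 (v) pp.24-25] -/
theorem isRealCat_const_base :
    IsRealCat ((Functor.const (Discrete PUnit.{1})).obj (FinEtale.base ℝ)) :=
  ⟨fun _ => isReal_base⟩

/-- **The universal closure of FACT-LIST row F-1087 is false**: "every object of every category over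
`D₀` is an RC-anchor" fails over the real point.  `RC.IsRCAnchor` is a DEFINITION ([FrdII] Def. 3.1 (v));
this refutes OUR universal closure, not a statement of the paper. [cite: MochizukiFrdII2008, Def 3.1 (v) p.25] -/
theorem not_forall_isRCAnchor :
    ¬ ∀ (𝓕 : Type) [Category.{0} 𝓕] (P : 𝓕 ⥤ ArchBase) (A : 𝓕), IsRCAnchor P A := fun h =>
  not_isRCAnchor_of_isRealCat _ isRealCat_const_base ⟨PUnit.unit⟩ (h _ _ _)

/-- **The universal closure of FACT-LIST row F-1089 is false** (no RC-subanchor over the real point).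
[cite: MochizukiFrdII2008, Def 3.1 (v) p.25] -/
theorem not_forall_isRCSubanchor :
    ¬ ∀ (𝓕 : Type) [Category.{0} 𝓕] (P : 𝓕 ⥤ ArchBase) (A : 𝓕), IsRCSubanchor P A := fun h =>
  not_isRCSubanchor_of_isRealCat _ isRealCat_const_base ⟨PUnit.unit⟩ (h _ _ _)

/-- **The universal closure of FACT-LIST row F-1088 is false** (no RC-iso-subanchor over the real
point). [cite: MochizukiFrdII2008, Def 3.1 (v) p.25] -/
theorem not_forall_isRCIsoSubanchor :
    ¬ ∀ (𝓕 : Type) [Category.{0} 𝓕] (P : 𝓕 ⥤ ArchBase) (A : 𝓕), IsRCIsoSubanchor P A := fun h =>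
  not_isRCIsoSubanchor_of_isRealCat _ isRealCat_const_base ⟨PUnit.unit⟩ (h _ _ _)

/-- **The universal closure of FACT-LIST row F-2354 is false**: the one-morphism category over the real
point is not of RC-iso-subanchor type (instance forms where it HOLDS: `ArchFrd.ptBase_isOfRCIsoSubanchorType`,
`ArchFrd.P35iiiStd.isOfRCIsoSubanchorType`, in the tree). [cite: MochizukiFrdII2008, Def 3.1 (v) p.25] -/
theorem not_forall_isOfRCIsoSubanchorType :
    ¬ ∀ (𝓕 : Type) [Category.{0} 𝓕] (P : 𝓕 ⥤ ArchBase), IsOfRCIsoSubanchorType P := fun h =>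
  not_isOfRCIsoSubanchorType_of_isRealCat _ isRealCat_const_base ⟨PUnit.unit⟩ (h _ _)

/-- **The universal closure of FACT-LIST row F-2355 is false**: the one-morphism category over the real
point is not of RC-standard type (instance forms where it HOLDS: `ArchFrd.P35iiiStd.isOfRCStandardType`,
`ArchimedeanProp35iCounterexampleStd.isOfRCStandardType`, in the tree). [cite: MochizukiFrdII2008, Def 3.1 (v) p.25] -/
theorem not_forall_isOfRCStandardType :
    ¬ ∀ (𝓕 : Type) [Category.{0} 𝓕] (P : 𝓕 ⥤ ArchBase), IsOfRCStandardType P := fun h =>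
  not_isOfRCStandardType_of_isRealCat _ isRealCat_const_base ⟨PUnit.unit⟩ (h _ _)

end RC

end Literature.AlgebraicGeometry.Frobenioids
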